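import Summits.ValiantsHypothesis.ValiantsHypothesis.Theorems.GrenetZeonDualUnipotentThreeHalvesLongMassSubmodule

/-!
# `GrenetZeon.DualUnipotentThreeHalves` (stmt-ValiantsHypothesis-24318), line `slow_core`, stub (c) `SlowCore.LongMassSlowLawInv`:
# THE INDEX SHADOW in the submodule currency — the LOWER side of the intrinsic (c)-price and the bridge to RelMMS

All rules landed so far in the coordinate-free currency of ✓ `longMassSlowLawInv_iff_submodule` bound the price from ABOVE.  The one general
LOWER-side instrument of the cell (✓ `LedgerIndex.linMat_pow_eq_zero_of_ledger`, pencil currency: ledger directions are nilpotent of index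
`≤ k + 1`) reads, intrinsically:

* ★ `pow_eq_zero_of_window` — if `(V, W)` has the window property at order `k` (window `n`) and `k + 1 ≤ n − 1`, then EVERY `w ∈ W` satisfies
  `w ^ (k + 1) = 0` (take the base point `A = 0 ∈ V`: the line is `s·w`, and `(s·w)^{k+1} = s^{k+1}·w^{k+1}` has entries of degree `k + 1`
  wherever `w^{k+1} ≠ 0`).
* ★★ `exists_boundedIndex_of_price` — hence a certificate of price `≤ P` at window `n` yields `k` and a sub-module `W ≤ V` with
  `n·k + (dim V − dim W) ≤ P` and (`n ≤ k + 2` or every `w ∈ W` has `w^{k+1} = 0`): the PRICE IS AT LEAST `min_k (n·k + t_{k+1}(V))`, where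
  `t_κ(V)` is the least codimension of a sub-module of `V` inside the index-`≤ κ` matrices — the quantity of crit-7's QUESTION RelMMS (V34 §6),
  now BY NAME in the same currency as (c) (type-I door: RelMMS bounds exactly this shadow; the mixed-word «deep mode» is what the shadow forgets).

Honest framing.  An instrument (`--supports stmt-ValiantsHypothesis-24318`), NOT progress on (c): (c) `SlowCore.LongMassSlowLawInv`, S3, the crux
24318, 8062 and `VP ≠ VNP` remain OPEN / NOT proved.  No sorry, no definitions, no named facts.
-/

-- single-conjunct layout: Sub = Summit, duplicated namespace component intended (the name is mandated)
set_option linter.dupNamespace false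
set_option autoImplicit false

noncomputable section

namespace Summit.ValiantsHypothesis.ValiantsHypothesis.Theorems.GrenetZeon.LongMassHomogenise

open MvPolynomial Matrix
open scoped BigOperators

variable {b : ℕ}

/-- The pure line `s·w`: `(0·C + s·w·C)^q = s^q · (w^q)·C`. -/
theorem lineMat_zero_pow (w : Matrix (Fin b) (Fin b) ℂ) (q : ℕ) :
    ((0 : Matrix (Fin b) (Fin b) ℂ).map (C : ℂ → MvPolynomial (Fin 1) ℂ) + (X 0 : MvPolynomial (Fin 1) ℂ) • w.map C) ^ q =
      (X 0 : MvPolynomial (Fin 1) ℂ) ^ q • (w ^ q).map C := by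
  rw [Matrix.map_zero C (map_zero C), zero_add, smul_pow,
    Matrix.map_pow (M := w) (f := (C : ℂ →+* MvPolynomial (Fin 1) ℂ))]

/-- ★ **THE INDEX SHADOW** (submodule currency): window order `k` with `k + 1 ≤ n − 1` forces `w ^ (k+1) = 0` for every direction `w ∈ W`. -/
theorem pow_eq_zero_of_window (V W : Submodule ℂ (Matrix (Fin b) (Fin b) ℂ)) {n k : ℕ} (hk : k + 1 ≤ n - 1)
    (hwin : ∀ A ∈ V, ∀ w ∈ W, ∀ p : ℕ, p ≤ n - 1 → ∀ i j : Fin b,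
      ((((A.map (C : ℂ → MvPolynomial (Fin 1) ℂ) + (X 0 : MvPolynomial (Fin 1) ℂ) • w.map C) ^ p :
        Matrix (Fin b) (Fin b) (MvPolynomial (Fin 1) ℂ)) i j).totalDegree ≤ k))
    {w : Matrix (Fin b) (Fin b) ℂ} (hw : w ∈ W) : w ^ (k + 1) = 0 := by
  ext i j
  rw [Matrix.zero_apply]
  by_contra hne
  have h := hwin 0 V.zero_mem w hw (k + 1) hk i j
  rw [lineMat_zero_pow, Matrix.smul_apply, Matrix.map_apply, smul_eq_mul] at h
  -- degree of `s^{k+1} · c` with `c ≠ 0` is `k + 1`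
  rw [mul_comm, C_mul_X_pow_eq_monomial, totalDegree_monomial _ hne, Finsupp.sum_single_index rfl] at h
  omega

/-- ★★ **LOWER SIDE OF THE PRICE / BRIDGE TO RelMMS**: a certificate of price `≤ P` at window `n` yields an order `k` and a sub-module `W ≤ V` of
codimension `≤ P − n·k` inside the index-`≤ k+1` matrices (or the degenerate case `n ≤ k + 2`). -/
theorem exists_boundedIndex_of_price (V : Submodule ℂ (Matrix (Fin b) (Fin b) ℂ)) {n P : ℕ}
    (h : ∃ (W : Submodule ℂ (Matrix (Fin b) (Fin b) ℂ)) (k : ℕ), W ≤ V ∧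
      (∀ A ∈ V, ∀ w ∈ W, ∀ p : ℕ, p ≤ n - 1 → ∀ i j : Fin b,
        ((((A.map (C : ℂ → MvPolynomial (Fin 1) ℂ) + (X 0 : MvPolynomial (Fin 1) ℂ) • w.map C) ^ p :
          Matrix (Fin b) (Fin b) (MvPolynomial (Fin 1) ℂ)) i j).totalDegree ≤ k)) ∧
      n * k + (Module.finrank ℂ V - Module.finrank ℂ W) ≤ P) :
    ∃ (W : Submodule ℂ (Matrix (Fin b) (Fin b) ℂ)) (k : ℕ), W ≤ V ∧
      n * k + (Module.finrank ℂ V - Module.finrank ℂ W) ≤ P ∧ (n ≤ k + 2 ∨ ∀ w ∈ W, w ^ (k + 1) = 0) := by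
  obtain ⟨W, k, hW, hwin, hprice⟩ := h
  refine ⟨W, k, hW, hprice, ?_⟩
  by_cases hk : k + 1 ≤ n - 1
  · exact Or.inr fun w hw => pow_eq_zero_of_window V W hk hwin hw
  · exact Or.inl (by omega)

end Summit.ValiantsHypothesis.ValiantsHypothesis.Theorems.GrenetZeon.LongMassHomogenise

end
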